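import Literature.MathematicalPhysics.QuantumFieldTheory.ConstructiveQFTWave0
import HarnessLib

-- provenance: harness21/H21/H21/Prelude/QLatticeAQFT/GaugeGroups.lean @ e9807c0 (interim HEAD d8f2665); M5 mechanical rewrite
/-!
# Concrete compact gauge groups (trunk `QLatticeAQFT`, outline A-D2 / item A8)

Wave 0 of the constructive-QFT family (`Literature.Statements.ConstructiveQFT.Wave0`) works with an
abstract compact Hausdorff group `G` (with `[MeasurableSpace G] [BorelSpace G]`, normalised Haar
measure `ConstructiveQFT.haarProbability G := haarMeasure ⊤`) and a matrix representation
`ρ : G →* Matrix (Fin N) (Fin N) ℂ`.  This prelude file supplies the *concrete* gauge groups of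
lattice gauge theory so that the abstract statements can be specialised:

* the instances that Mathlib (at the pinned commit) does **not** provide — verified absent by
  grepping `CompactSpace`/`MeasurableSpace`/`BorelSpace` for `unitary`, `Matrix.unitaryGroup`,
  `Matrix.specialUnitaryGroup`: compactness of `U(n)` over an `RCLike` field and of `SU(n)`,
  the topological-group structure of `SU(n)` (Mathlib has it for `unitary R`, hence for
  `Matrix.unitaryGroup`, via `instIsTopologicalGroupUnitary`, but `Matrix.specialUnitaryGroup` is
  a bare `Submonoid` with a hand-rolled `Group` instance), and the Borel σ-algebras;
* the fact that `haarProbability G` is a probability measure (answering Wave 0's TODO, see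
  `Literature.MathematicalPhysics.QuantumFieldTheory.haarProbability.instIsProbabilityMeasure`);
* the fundamental representation of `SU(n)` (Mathlib's `Submonoid.subtype`), the normalised
  character `(1/N) Re tr`, the predicates "`G` has a faithful continuous unitary representation
  of degree `N`" and "`G` is a compact simple (non-abelian) group", and the one-dimensional
  representations of the finite/abelian gauge groups `ℤ₂` and `U(1) = Circle`.

Mathlib anchors used (all grepped at the pin): `Matrix.unitaryGroup` (`= unitary (Matrix n n α)`),
`Matrix.specialUnitaryGroup`, `isClosed_unitary`, `entry_norm_bound_of_unitary`,
`isCompact_univ_pi`, `MeasureTheory.Measure.haarMeasure_self`, `Circle`,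
`Circle.coeHom`, `Matrix.scalar`.

Sources: T. Bröcker, T. tom Dieck, *Representations of Compact Lie Groups* (1985), Ch. I §1
(examples (1.9)–(1.11): `U(n)`, `SU(n)` compact; §4 faithful representations);
M. Sepanski, *Compact Lie Groups* (2007), Ch. 1 (§1.1.2–1.1.4 compactness of the classical
groups, §1.3 simple compact groups); E. Seiler, LNP 159 (1982) Ch. 1 (gauge groups of lattice
gauge theory).

## Design choices

* Instances on Mathlib types are declared at top level under the names
  `Matrix.unitaryGroup.inst…` / `Matrix.specialUnitaryGroup.inst…` (deliberate extensions of
  Mathlib namespaces; none of them duplicates an existing Mathlib instance).  The order matters: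
  `CompactSpace (unitaryGroup n 𝕜)` first (so that `LocallyCompactSpace`, needed by
  `Measure.haarMeasure`, is found), then the topological group structure and compactness of
  `SU(n)`, then `MeasurableSpace := borel _` and `BorelSpace := ⟨rfl⟩` for both.
* We KEEP Wave 0's idiom `haarProbability G := haarMeasure ⊤` (an explicit measure) rather than
  switching to `[MeasureSpace G] [IsHaarMeasure volume] [IsProbabilityMeasure volume]`: the
  concrete groups `U(n)`, `SU(n)` carry no canonical `MeasureSpace` instance in Mathlib, and
  declaring one here would be a global instance on a Mathlib type with real risk of future
  collision; the explicit measure keeps all downstream statements instance-free.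
* "Compact simple Lie group" is phrased without Lie theory (absent for these groups in Mathlib):
  `IsSimpleCompactGroup G` asks that `G` be connected, non-abelian, and that every closed
  connected normal subgroup be trivial or everything (Sepanski Def. 1.34 / Bröcker–tom Dieck
  V (7.11): the Lie algebra is simple ⇔ no proper non-trivial closed connected normal
  subgroups).  Manifold structure is replaced by `HasFaithfulUnitaryRep G N` (a closed subgroup
  of `U(N)` is automatically a Lie group).
-/

open MeasureTheory TopologicalSpace Filter Complex

noncomputable section

/-! ## Instances on `U(n)` and `SU(n)` -/

section Instances

variable {n : Type*} [DecidableEq n] [Fintype n] {𝕜 : Type*} [RCLike 𝕜]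

/-- The unitary group `U(n, 𝕜)` (`𝕜 = ℝ` or `ℂ`) is compact: it is closed (`isClosed_unitary`)
and contained in the compact product of closed unit discs (every entry has norm `≤ 1`,
`entry_norm_bound_of_unitary`) (Bröcker–tom Dieck I (1.9); Sepanski §1.1.3).
Not in Mathlib at the pin. [folklore] -/
instance Matrix.unitaryGroup.instCompactSpace : CompactSpace (Matrix.unitaryGroup n 𝕜) := by
  haveI : ProperSpace 𝕜 := FiniteDimensional.proper_rclike 𝕜 𝕜
  refine isCompact_iff_compactSpace.mp ?_
  -- the product of closed unit balls, a compact subset of `Matrix n n 𝕜 = n → n → 𝕜`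
  have hS : IsCompact (X := Matrix n n 𝕜)
      (Set.univ.pi fun _ : n => Set.univ.pi fun _ : n => Metric.closedBall (0 : 𝕜) 1) :=
    isCompact_univ_pi fun _ => isCompact_univ_pi fun _ => isCompact_closedBall (0 : 𝕜) 1
  refine hS.of_isClosed_subset isClosed_unitary ?_
  intro U hU i _ j _
  simpa only [Metric.mem_closedBall, dist_zero_right] using entry_norm_bound_of_unitary hU i j

/-- Inversion (`= star`, the conjugate transpose) is continuous on `SU(n)`.
Not in Mathlib at the pin (Mathlib only equips `unitary R`). [folklore] -/
instance Matrix.specialUnitaryGroup.instContinuousInv :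
    ContinuousInv (Matrix.specialUnitaryGroup n 𝕜) where
  continuous_inv := by
    refine Continuous.subtype_mk ?_ _
    exact continuous_subtype_val.matrix_conjTranspose

/-- `SU(n)` is a topological group for the topology induced from the matrices
(Bröcker–tom Dieck I (1.10); Sepanski §1.1.4).  Multiplication is continuous by
`Submonoid.continuousMul`; inversion by `Matrix.specialUnitaryGroup.instContinuousInv`.
Not in Mathlib at the pin. [folklore] -/
instance Matrix.specialUnitaryGroup.instIsTopologicalGroup :
    IsTopologicalGroup (Matrix.specialUnitaryGroup n 𝕜) where

/-- `SU(n)` is compact: it is the closed subset `det = 1` of the compact group `U(n)`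
(Bröcker–tom Dieck I (1.10); Sepanski §1.1.4).  Not in Mathlib at the pin. [folklore] -/
instance Matrix.specialUnitaryGroup.instCompactSpace :
    CompactSpace (Matrix.specialUnitaryGroup n 𝕜) := by
  refine isCompact_iff_compactSpace.mp ?_
  have hU : IsCompact (Matrix.unitaryGroup n 𝕜 : Set (Matrix n n 𝕜)) :=
    isCompact_iff_compactSpace.mpr Matrix.unitaryGroup.instCompactSpace
  have hdet : IsClosed {A : Matrix n n 𝕜 | A.det = 1} :=
    isClosed_eq (continuous_id.matrix_det) continuous_const
  have : (Matrix.specialUnitaryGroup n 𝕜 : Set (Matrix n n 𝕜)) =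
      (Matrix.unitaryGroup n 𝕜 : Set (Matrix n n 𝕜)) ∩ {A | A.det = 1} := by
    ext A
    simp [Matrix.mem_specialUnitaryGroup_iff]
  rw [this]
  exact hU.inter_right hdet

/-- The Borel σ-algebra on `U(n)`.  Not in Mathlib at the pin (matrices carry no
`MeasurableSpace` instance). [folklore] -/
instance Matrix.unitaryGroup.instMeasurableSpace : MeasurableSpace (Matrix.unitaryGroup n 𝕜) :=
  borel _

/-- `U(n)` with `Matrix.unitaryGroup.instMeasurableSpace` is a Borel space (by definition). [folklore] -/
instance Matrix.unitaryGroup.instBorelSpace : BorelSpace (Matrix.unitaryGroup n 𝕜) := ⟨rfl⟩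

/-- The Borel σ-algebra on `SU(n)`.  Not in Mathlib at the pin. [folklore] -/
instance Matrix.specialUnitaryGroup.instMeasurableSpace :
    MeasurableSpace (Matrix.specialUnitaryGroup n 𝕜) :=
  borel _

/-- `SU(n)` with `Matrix.specialUnitaryGroup.instMeasurableSpace` is a Borel space
(by definition). [folklore] -/
instance Matrix.specialUnitaryGroup.instBorelSpace :
    BorelSpace (Matrix.specialUnitaryGroup n 𝕜) := ⟨rfl⟩

end Instances

namespace Literature.MathematicalPhysics.QuantumLattice

/-- The normalised Haar measure `ConstructiveQFT.haarProbability G = haarMeasure ⊤` of a compact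
group is a probability measure (`MeasureTheory.Measure.haarMeasure_self` applied to the positive
compact set `⊤ = univ`; Bröcker–tom Dieck I (5.11)).

**Design decision (answers the TODO in Wave 0's `haarProbability` docstring):** the trunk keeps
the explicit-measure idiom `haarProbability G := haarMeasure ⊤` rather than the typeclass idiom
`[MeasureSpace G] [IsHaarMeasure volume] [IsProbabilityMeasure volume]`, because the concrete
gauge groups `Matrix.unitaryGroup n ℂ`, `Matrix.specialUnitaryGroup n ℂ` have no canonical
`MeasureSpace` instance in Mathlib and we do not want to declare global `volume`s on Mathlib
types; with this instance every `[IsProbabilityMeasure _]` obligation downstream is automatic. [folklore] -/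
instance _root_.Literature.MathematicalPhysics.QuantumFieldTheory.haarProbability.instIsProbabilityMeasure (G : Type*) [Group G]
    [TopologicalSpace G] [IsTopologicalGroup G] [CompactSpace G] [MeasurableSpace G]
    [BorelSpace G] : IsProbabilityMeasure (QuantumFieldTheory.haarProbability G) where
  measure_univ := by
    rw [QuantumFieldTheory.haarProbability, ← PositiveCompacts.coe_top]
    exact Measure.haarMeasure_self

section QLatticeAQFT

/-! ## The fundamental representation of `SU(n)` -/

section Fundamental

variable (n : Type*) [DecidableEq n] [Fintype n] (𝕜 : Type*) [RCLike 𝕜]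

/-- The fundamental (defining) representation of `SU(n)` on `ℂⁿ`, as a monoid homomorphism into
matrices: the inclusion `SU(n) ↪ M_n(ℂ)` (Mathlib's `Submonoid.subtype`)
(Bröcker–tom Dieck I (1.10), II §1; Sepanski §2.1.1). [folklore] -/
def fundamentalRep : Matrix.specialUnitaryGroup n ℂ →* Matrix n n ℂ :=
  (Matrix.specialUnitaryGroup n ℂ).subtype

/-- The fundamental (defining) representation of `U(n, 𝕜)` on `𝕜ⁿ`: the inclusion
`U(n) ↪ M_n(𝕜)` (Bröcker–tom Dieck I (1.9); Sepanski §2.1.1). [folklore] -/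
def unitaryFundamentalRep : Matrix.unitaryGroup n 𝕜 →* Matrix n n 𝕜 :=
  (Matrix.unitaryGroup n 𝕜).subtype

variable {n 𝕜}

/-- The fundamental representation of `SU(n)` is the underlying matrix. [folklore] -/
@[simp]
theorem fundamentalRep_apply (U : Matrix.specialUnitaryGroup n ℂ) :
    fundamentalRep n U = (U : Matrix n n ℂ) := rfl

/-- The fundamental representation of `U(n)` is the underlying matrix. [folklore] -/
@[simp]
theorem unitaryFundamentalRep_apply (U : Matrix.unitaryGroup n 𝕜) :
    unitaryFundamentalRep n 𝕜 U = (U : Matrix n n 𝕜) := rfl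

variable (n) in
/-- The fundamental representation of `SU(n)` is continuous (it is a subtype inclusion)
(Bröcker–tom Dieck I (1.10)). [folklore] -/
theorem continuous_fundamentalRep : Continuous (fundamentalRep n) :=
  continuous_subtype_val

variable (n) in
/-- The fundamental representation of `SU(n)` is faithful (Bröcker–tom Dieck I (1.10)). [folklore] -/
theorem fundamentalRep_injective : Function.Injective (fundamentalRep n) :=
  Subtype.val_injective

/-- The fundamental representation of `SU(n)` is unitary: its values lie in `U(n)`
(Bröcker–tom Dieck I (1.10)). [folklore] -/
theorem fundamentalRep_mem_unitaryGroup (U : Matrix.specialUnitaryGroup n ℂ) :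
    fundamentalRep n U ∈ Matrix.unitaryGroup n ℂ :=
  Matrix.specialUnitaryGroup_le_unitaryGroup U.2

variable (n 𝕜) in
/-- The fundamental representation of `U(n)` is continuous (Bröcker–tom Dieck I (1.9)). [folklore] -/
theorem continuous_unitaryFundamentalRep : Continuous (unitaryFundamentalRep n 𝕜) :=
  continuous_subtype_val

variable (n 𝕜) in
/-- The fundamental representation of `U(n)` is faithful (Bröcker–tom Dieck I (1.9)). [folklore] -/
theorem unitaryFundamentalRep_injective : Function.Injective (unitaryFundamentalRep n 𝕜) :=
  Subtype.val_injective

end Fundamental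

/-! ## Normalised character, faithful unitary representations, simplicity -/

/-- The normalised character `χ(M) = (1/N) Re tr M` of an `N × N` complex matrix, the quantity
entering the Wilson action and Wilson loops (`(1/N) Re tr ρ(U_p)`; Seiler LNP 159 Ch. 1;
Chatterjee arXiv:1803.01950 §2).  For `N = 0` this is the junk value `0` (`(0 : ℝ)⁻¹ = 0`). [cite: arXiv180301950] -/
def normalisedCharacter (N : ℕ) (M : Matrix (Fin N) (Fin N) ℂ) : ℝ :=
  (N : ℝ)⁻¹ * M.trace.re

/-- The normalised character of the identity is `1` (`N ≥ 1`). [folklore] -/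
@[simp]
theorem normalisedCharacter_one (N : ℕ) [NeZero N] :
    normalisedCharacter N (1 : Matrix (Fin N) (Fin N) ℂ) = 1 := by
  simp [normalisedCharacter, Matrix.trace_one, NeZero.ne N]

/-- `HasFaithfulUnitaryRep G N`: the topological group `G` admits a faithful continuous unitary
representation of degree `N`, i.e. a continuous injective homomorphism `ρ : G →* M_N(ℂ)` with
values in `U(N)`.  For compact `G` this says `G` is (isomorphic to) a closed subgroup of `U(N)`,
hence a compact Lie group (Bröcker–tom Dieck I §4 and III (4.1); Sepanski Thm. 3.28).  This is
the v0 substitute for a Lie-group structure on the gauge group. [folklore] -/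
def HasFaithfulUnitaryRep (G : Type*) [Group G] [TopologicalSpace G] (N : ℕ) : Prop :=
  ∃ ρ : G →* Matrix (Fin N) (Fin N) ℂ,
    Continuous ρ ∧ Function.Injective ρ ∧ ∀ g, ρ g ∈ Matrix.unitaryGroup (Fin N) ℂ

/-- `IsSimpleCompactGroup G`: the (compact) topological group `G` is *simple* in the sense of
compact Lie groups — connected, non-abelian, and every closed connected normal subgroup is
trivial or the whole group (Sepanski Def. 1.34; Bröcker–tom Dieck V (7.11)–(7.13): equivalent
to simplicity of the Lie algebra).  Note that finite central subgroups are allowed (`SU(n)` is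
simple in this sense although its centre is `ℤ/n`).  Compactness is not part of the predicate; it
is supplied by a `[CompactSpace G]` hypothesis where needed. [folklore] -/
def IsSimpleCompactGroup (G : Type*) [Group G] [TopologicalSpace G] : Prop :=
  ConnectedSpace G ∧ (∃ a b : G, a * b ≠ b * a) ∧
    ∀ N : Subgroup G, N.Normal → IsClosed (N : Set G) → IsPreconnected (N : Set G) →
      N = ⊥ ∨ N = ⊤

/-- `SU(n)` has a faithful continuous unitary representation of degree `n`, namely the
fundamental one (Bröcker–tom Dieck I (1.10)). [folklore] -/
theorem hasFaithfulUnitaryRep_specialUnitaryGroup (N : ℕ) :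
    HasFaithfulUnitaryRep (Matrix.specialUnitaryGroup (Fin N) ℂ) N :=
  ⟨fundamentalRep (Fin N), continuous_fundamentalRep (Fin N), fundamentalRep_injective (Fin N),
    fundamentalRep_mem_unitaryGroup⟩

/-- `SU(n)` is a simple compact group for `n ≥ 2`: it is connected, non-abelian, and its Lie
algebra `𝔰𝔲(n)` is simple, so its only closed connected normal subgroups are `1` and `SU(n)`
(Bröcker–tom Dieck I (1.10), V (7.13) and the classification table V (8.1); Sepanski
§1.3 and Thm. 6.36). [cite: BrockerTomDieck1985, I (1.10) and V (7.13) with the table V (8.1)] [cite: Sepanski2007, §1.3 and Thm. 6.36] -/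
def isSimpleCompactGroup_specialUnitaryGroup : Prop :=
  ∀ {n : Type*} [DecidableEq n] [Fintype n] (h : 2 ≤ Fintype.card n),
    IsSimpleCompactGroup (Matrix.specialUnitaryGroup n ℂ)

/-- `U(n)` (`n` non-empty) is not a simple compact group: for `card n = 1` it is abelian, and
for `card n ≥ 2` the closed connected normal subgroup `SU(n)` (or the centre `U(1)·1`) is proper
and non-trivial (Bröcker–tom Dieck I (1.9)–(1.10); Sepanski §1.3). [cite: BrockerTomDieck1985, I (1.9)–(1.10)] [cite: Sepanski2007, §1.3] -/
def not_isSimpleCompactGroup_unitaryGroup : Prop :=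
  ∀ {n : Type*} [DecidableEq n] [Fintype n] [Nonempty n],
    ¬ IsSimpleCompactGroup (Matrix.unitaryGroup n ℂ)

/-! ## Finite and abelian gauge groups: `ℤ₂` and `U(1)` -/

/-- The sign representation of `ℤ₂ = Multiplicative (ZMod 2)` on `ℂ`, `a ↦ (-1)^a`, as a
`1 × 1` matrix representation (the gauge group of `ℤ₂` lattice gauge theory; Seiler LNP 159
Ch. 1; Wegner, J. Math. Phys. 12 (1971) 2259). [folklore] -/
def z2Rep : Multiplicative (ZMod 2) →* Matrix (Fin 1) (Fin 1) ℂ where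
  toFun a := ((-1 : ℂ) ^ a.toAdd.val) • (1 : Matrix (Fin 1) (Fin 1) ℂ)
  map_one' := by simp
  map_mul' a b := by
    rw [smul_mul_smul_comm, one_mul, ← pow_add, toAdd_mul, ZMod.val_add,
      ← neg_one_pow_eq_pow_mod_two]

/-- `z2Rep a = (-1)^a • 1`. [folklore] -/
@[simp]
theorem z2Rep_apply (a : Multiplicative (ZMod 2)) :
    z2Rep a = ((-1 : ℂ) ^ a.toAdd.val) • (1 : Matrix (Fin 1) (Fin 1) ℂ) := rfl

/-- The values of `z2Rep` are unitary (`(±1)` is unitary). [folklore] -/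
theorem z2Rep_mem_unitaryGroup (a : Multiplicative (ZMod 2)) :
    z2Rep a ∈ Matrix.unitaryGroup (Fin 1) ℂ := by
  rw [z2Rep_apply, Matrix.mem_unitaryGroup_iff]
  simp only [star_smul, star_pow, star_neg, star_one, smul_mul_smul_comm, one_mul, ← mul_pow,
    neg_mul_neg, one_pow, one_smul]

/-- The defining representation of `U(1) = Circle` on `ℂ`, `z ↦ (z)`, as a `1 × 1` matrix
representation (compact abelian / `U(1)` lattice gauge theory; Seiler LNP 159 Ch. 1;
Guth, Phys. Rev. D 21 (1980) 2291).  Built from Mathlib's `Circle.coeHom` and `Matrix.scalar`. [folklore] -/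
def u1Rep : Circle →* Matrix (Fin 1) (Fin 1) ℂ :=
  (Matrix.scalar (Fin 1) : ℂ →+* Matrix (Fin 1) (Fin 1) ℂ).toMonoidHom.comp Circle.coeHom

/-- `u1Rep z` is the scalar matrix `z`. [folklore] -/
@[simp]
theorem u1Rep_apply (z : Circle) : u1Rep z = Matrix.scalar (Fin 1) (z : ℂ) := rfl

/-- The defining representation of `U(1)` is continuous. [folklore] -/
theorem continuous_u1Rep : Continuous u1Rep := by
  have hcoe : Continuous fun z : Circle => (z : ℂ) := continuous_subtype_val
  exact (continuous_pi fun _ : Fin 1 => hcoe).matrix_diagonal.congr fun z => by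
    simp [u1Rep_apply, Matrix.scalar_apply]

/-- The defining representation of `U(1)` is faithful. [folklore] -/
theorem u1Rep_injective : Function.Injective u1Rep := fun z w h => by
  have := congrArg (fun M : Matrix (Fin 1) (Fin 1) ℂ => M 0 0) h
  exact Circle.ext (by simpa using this)

/-- The values of `u1Rep` are unitary (`z̄ z = 1` on the circle). [folklore] -/
theorem u1Rep_mem_unitaryGroup (z : Circle) : u1Rep z ∈ Matrix.unitaryGroup (Fin 1) ℂ := by
  rw [u1Rep_apply, Matrix.mem_unitaryGroup_iff, Matrix.scalar_apply, Matrix.star_eq_conjTranspose,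
    Matrix.diagonal_conjTranspose, Matrix.diagonal_mul_diagonal, ← Matrix.diagonal_one]
  congr 1
  funext i
  simp only [Pi.star_apply, Complex.star_def, Complex.mul_conj', Circle.norm_coe]
  simp

/-- `U(1) = Circle` has a faithful continuous unitary representation of degree `1`. [folklore] -/
theorem hasFaithfulUnitaryRep_circle : HasFaithfulUnitaryRep Circle 1 :=
  ⟨u1Rep, continuous_u1Rep, u1Rep_injective, u1Rep_mem_unitaryGroup⟩

end QLatticeAQFT

end Literature.MathematicalPhysics.QuantumLattice
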